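import Summits.QuantumFields.YangMills.Theorems.BalabanUVNodesN07QuadPartReality
import Literature.MathematicalPhysics.QuantumFieldTheory.Balaban1983to89.B11Eq80Current
import HarnessLib

/-!
# NODE N07 — SECT. C's INNER FIXED POINT ON THE REAL SLICE: for Hermitian `A′` with `‖A′‖ < a_C`, `HD(A′) = Emap H♭ C^{𝔰𝔩} ε_C A′` ((47)–(49): `A = H(C(A′ − A))`),
# `T47 A′`, `HD₃(A′) = E3 …` are HERMITIAN and `D(HD)(A′)` maps Hermitian directions to Hermitian jets — the `H`∕`C` half of the «`W` maps real to real» ROW of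
# def-Y's `ChartSUTok` reading ([15] (45)–(50) p. 285, (78) p. 290; [B9] p. 392)

Cell `pub-ymgap`, width seat `pub-ymgap-dag-n07-w3` (g26), CLAIM-10.  `--kind proof --supports stmt-QuantumFields-27238 --as helper`; count-neutral.
[15] = [Balaban1985Variational]; [B9] = [Balaban1985BackgroundPropagators].

THE ARGUMENT.  The (47) map `X ↦ −H(C(X + A′))` is the `mapT H 0 C 0 A′` contraction of lit's Prop. 6 scheme; under Sect. C's regime (DISPLAYED: `Regime H 0 C b 0 C₂ c₄ 0 a_C ε_C`,
def-Y's `Prop4LetterH`∕`Prop4LetterC` currency) its fixed point lies in every closed invariant set containing `0` (lit ✓`B11Prop6Scheme.solution_mem_of_invariant`).  The set of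
HERMITIAN jets (fixed points of the bondwise conjugation of the space (115)) is closed and invariant as soon as `H` is real (✓p821715 for `H♭`) and `C` maps Hermitian jets of norm
`≤ ε_C + a_C` to Hermitian block fields (DISPLAYED `hCreal` — ✓`…N07COfRecordRealSliceNhds` gives it on a neighbourhood of `0`; matching that neighbourhood with Sect. C's radii is the
small-field bookkeeping, not done here).  Derivatives of a Hermitian-valued map along Hermitian directions are Hermitian (✓`fixed_of_hasDerivAt`).
* §1 `continuous_conjJet`, `isClosed_hermJet` (the real slice of the space (115) of record is closed).
* §2 ★★`conjJet_Emap_eq` — `HD(A′)ᴴ = HD(A′)` for Hermitian `A′`, `‖A′‖ < a_C` (abstract real `H`, real-slice `C`, regime); `conjJet_T47_eq`.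
* §3 at def-Y's letters `H♭ := H1OfRecordAtBgFlat`, `C^{𝔰𝔩} := CslOfRecord` (guard): ★★`conjJet_EmapOfRecord_eq`, `conjJet_T47OfRecord_eq`, ★★`conjJet_E3OfRecord_eq` (`HD₃ = HD − H♭C⁽²⁾`, with
  ✓p821931 `quadPart_CslOfRecord_conj`), ★★`conjJet_fderiv_EmapOfRecord_eq` (`(D(HD)(A′)Y)ᴴ = D(HD)(A′)Y` for Hermitian `A′`, `Y`; lit ✓`analyticOnNhd_Emap`).

HONEST LABELS.  Bookkeeping over lit's (47) contraction; the regime, `Prop4Hyp` and `hCreal` are DISPLAYED hypotheses (Bałaban's Sect. C estimates), NOT proved; the `J`, `Δπ`,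
transpose and `V₀`-group letters of `W` are NOT here.  Count-neutral; N07 NOT discharged; P0 ⟨26900⟩ OPEN; R4 is the conditional finite-𝕋⁴ rung only.  Nothing here is a claim
about the Yang–Mills mass gap (`Summit.QuantumFields`): finite torus, fixed `ε`; nothing continuum ∕ OS ∕ Clay.
-/

set_option autoImplicit false

noncomputable section

open scoped Matrix Matrix.Norms.L2Operator InnerProductSpace ComplexConjugate Topology

namespace Summit.QuantumFields.YangMills.Theorems.N07EmapOfRecordRealSlice

open Filter Metric
open Literature.MathematicalPhysics.QuantumFieldTheory.Balaban1983to89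
open Literature.MathematicalPhysics.QuantumFieldTheory.Balaban1983to89.T4Continuum (T4Family)
open T4Continuum BlockAveraging
open B9SectCLatticeCarrier (Bond)
open B11Eq111FrakG (nabla115)
open B11Eq115Space (NegSize NegSup levWeight JetSup)
open B11Eq80Current (Emap Emap_eq_sub quadPart E3 analyticOnNhd_Emap)
open B11Eq90V0GroupComposed (T47 T47_apply)
open B11Eq174Chart (Regime solA)
open B11Prop6Scheme (mapT mapT_apply Prop4Hyp solution_mem_of_invariant)
open Node00
open Summit.QuantumFields.YangMills.Theorems.N07H1OfRecordReality (equiv_H1OfRecordAtBgFlat_star)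
open Summit.QuantumFields.YangMills.Theorems.N07QuadPartReality (fixed_of_hasDerivAt conjJet_add conjJet_sub conjJet_smul conjJet_conjJet hasDerivAt_realLine
  quadPart_CslOfRecord_conj)

variable (F : T4Family) (N : ℕ) (K : ℕ) (k : ℕ) (Ω : ℕ → Set (Site (F.P K) 0)) (U₀ : GaugeField (F.P K) 0 (SU N))
  [Fact (0 < (F.L : ℝ))] [Fact (0 < (F.P K).eta k)] (levB : PBond (F.P K) k → ℕ)

/-! ## §1  The real slice of the space (115) of record is closed -/

/-- The bondwise conjugation of the space (115) of record is continuous (real-linear, finite dimension). [folklore] -/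
theorem continuous_conjJet :
    Continuous fun A : Space115Lit F N K k Ω U₀ =>
      ((JetSup.equiv _ _ (nabla115 ((F.P K).eta k) (unitsOfRecord F N U₀))).symm
        (star (JetSup.equiv _ _ (nabla115 ((F.P K).eta k) (unitsOfRecord F N U₀)) A)) : Space115Lit F N K k Ω U₀) := by
  let σ : Space115Lit F N K k Ω U₀ →ₗ[ℝ] Space115Lit F N K k Ω U₀ :=
    { toFun := fun A => (JetSup.equiv _ _ (nabla115 ((F.P K).eta k) (unitsOfRecord F N U₀))).symm
        (star (JetSup.equiv _ _ (nabla115 ((F.P K).eta k) (unitsOfRecord F N U₀)) A))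
      map_add' := fun A B => conjJet_add F N K k Ω U₀ A B
      map_smul' := fun r A => by
        rw [RingHom.id_apply, ← Complex.coe_smul, ← Complex.coe_smul, conjJet_smul, Complex.conj_ofReal] }
  exact σ.continuous_of_finiteDimensional

/-- **THE HERMITIAN JETS FORM A CLOSED SET** in the space (115) of record. [cite: Balaban1985Variational, (19) p.281, (51) p.286, (115) p.294] -/
theorem isClosed_hermJet :
    IsClosed {A : Space115Lit F N K k Ω U₀ |
      ((JetSup.equiv _ _ (nabla115 ((F.P K).eta k) (unitsOfRecord F N U₀))).symm
        (star (JetSup.equiv _ _ (nabla115 ((F.P K).eta k) (unitsOfRecord F N U₀)) A)) : Space115Lit F N K k Ω U₀) = A} :=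
  isClosed_eq (continuous_conjJet F N K k Ω U₀) continuous_id

omit [Fact (0 < (F.L : ℝ))] [Fact (0 < (F.P K).eta k)] in
/-- `0ᴴ = 0` on the space (115) of record. [cite: Balaban1985Variational, (115) p.294 (bookkeeping)] -/
theorem conjJet_zero :
    ((JetSup.equiv _ _ (nabla115 ((F.P K).eta k) (unitsOfRecord F N U₀))).symm
        (star (JetSup.equiv _ _ (nabla115 ((F.P K).eta k) (unitsOfRecord F N U₀)) (0 : Space115Lit F N K k Ω U₀))) : Space115Lit F N K k Ω U₀) = 0 := by
  apply (JetSup.equiv _ _ (nabla115 ((F.P K).eta k) (unitsOfRecord F N U₀))).injective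
  rw [Equiv.apply_symm_apply, JetSup.equiv_zero, star_zero]

omit [Fact (0 < (F.L : ℝ))] [Fact (0 < (F.P K).eta k)] in
/-- `(−A)ᴴ = −Aᴴ` on the space (115) of record. [cite: Balaban1985Variational, (115) p.294 (bookkeeping)] -/
theorem conjJet_neg (A : Space115Lit F N K k Ω U₀) :
    ((JetSup.equiv _ _ (nabla115 ((F.P K).eta k) (unitsOfRecord F N U₀))).symm
        (star (JetSup.equiv _ _ (nabla115 ((F.P K).eta k) (unitsOfRecord F N U₀)) (-A))) : Space115Lit F N K k Ω U₀) =
      -(JetSup.equiv _ _ (nabla115 ((F.P K).eta k) (unitsOfRecord F N U₀))).symm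
        (star (JetSup.equiv _ _ (nabla115 ((F.P K).eta k) (unitsOfRecord F N U₀)) A)) := by
  rw [← neg_one_smul ℂ A, conjJet_smul, map_neg, map_one, neg_one_smul]

/-! ## §2  `HD(A′)` on the real slice, abstract real `H` and real-slice `C` -/

section Abstract

variable {H : NegSize (F.L : ℝ) ((F.P K).eta k) levB 0 (Matrix (Fin N) (Fin N) ℂ) →L[ℂ] Space115Lit F N K k Ω U₀}
  {C : Space115Lit F N K k Ω U₀ → NegSize (F.L : ℝ) ((F.P K).eta k) levB 0 (Matrix (Fin N) (Fin N) ℂ)} {b C₂ c₄ aC εC : ℝ}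

/-- ★★ **`HD(A′) = Emap H C ε_C A′` IS HERMITIAN FOR HERMITIAN `A′` WITH `‖A′‖ < a_C`** — under Sect. C's regime (displayed), for `H` REAL and `C` mapping Hermitian jets of norm
`≤ ε_C + a_C` to Hermitian block fields: the (47) contraction preserves the closed real slice, so its fixed point lies in it (lit ✓`solution_mem_of_invariant`).
[cite: Balaban1985Variational, (45)–(50) p.285; Balaban1985BackgroundPropagators, p.392] -/
theorem conjJet_Emap_eq (RC : Regime H 0 C b 0 C₂ c₄ 0 aC εC)
    (hH : ∀ B : NegSize (F.L : ℝ) ((F.P K).eta k) levB 0 (Matrix (Fin N) (Fin N) ℂ),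
      ((JetSup.equiv _ _ (nabla115 ((F.P K).eta k) (unitsOfRecord F N U₀))).symm
          (star (JetSup.equiv _ _ (nabla115 ((F.P K).eta k) (unitsOfRecord F N U₀)) (H B))) : Space115Lit F N K k Ω U₀) =
        H ((NegSup.equiv _ _).symm (star (NegSup.equiv _ _ B))))
    (hCreal : ∀ A : Space115Lit F N K k Ω U₀,
      ((JetSup.equiv _ _ (nabla115 ((F.P K).eta k) (unitsOfRecord F N U₀))).symm
          (star (JetSup.equiv _ _ (nabla115 ((F.P K).eta k) (unitsOfRecord F N U₀)) A)) : Space115Lit F N K k Ω U₀) = A →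
      ‖A‖ ≤ εC + aC → ((NegSup.equiv _ _).symm (star (NegSup.equiv _ _ (C A))) : NegSize (F.L : ℝ) ((F.P K).eta k) levB 0 (Matrix (Fin N) (Fin N) ℂ)) = C A)
    {A' : Space115Lit F N K k Ω U₀}
    (hA' : ((JetSup.equiv _ _ (nabla115 ((F.P K).eta k) (unitsOfRecord F N U₀))).symm
      (star (JetSup.equiv _ _ (nabla115 ((F.P K).eta k) (unitsOfRecord F N U₀)) A')) : Space115Lit F N K k Ω U₀) = A') (hn : ‖A'‖ < aC) :
    ((JetSup.equiv _ _ (nabla115 ((F.P K).eta k) (unitsOfRecord F N U₀))).symm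
        (star (JetSup.equiv _ _ (nabla115 ((F.P K).eta k) (unitsOfRecord F N U₀)) (Emap H C εC A'))) : Space115Lit F N K k Ω U₀) = Emap H C εC A' := by
  have hJ : ‖(0 : NegSize (F.L : ℝ) ((F.P K).eta k) levB 0 (Matrix (Fin N) (Fin N) ℂ))‖ ≤ 0 := by rw [norm_zero]
  have hsol := RC.solA_mem hJ hn
  -- the fixed point lies in the closed invariant real slice
  have hmem : solA H 0 C 0 εC A' ∈ {A : Space115Lit F N K k Ω U₀ |
      ((JetSup.equiv _ _ (nabla115 ((F.P K).eta k) (unitsOfRecord F N U₀))).symm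
        (star (JetSup.equiv _ _ (nabla115 ((F.P K).eta k) (unitsOfRecord F N U₀)) A)) : Space115Lit F N K k Ω U₀) = A} := by
    refine solution_mem_of_invariant RC.norm_G RC.norm_L RC.quad RC.B₀_nonneg RC.C₄_nonneg RC.θ_nonneg hJ hn RC.ε₄_nonneg RC.dom RC.self RC.contr
      _ (isClosed_hermJet F N K k Ω U₀) (conjJet_zero F N K k Ω U₀) (fun X hX hXn => ?_) hsol.1 hsol.2
    have hX' : ((JetSup.equiv _ _ (nabla115 ((F.P K).eta k) (unitsOfRecord F N U₀))).symm
        (star (JetSup.equiv _ _ (nabla115 ((F.P K).eta k) (unitsOfRecord F N U₀)) X)) : Space115Lit F N K k Ω U₀) = X := hX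
    have hXA : ((JetSup.equiv _ _ (nabla115 ((F.P K).eta k) (unitsOfRecord F N U₀))).symm
        (star (JetSup.equiv _ _ (nabla115 ((F.P K).eta k) (unitsOfRecord F N U₀)) (X + A'))) : Space115Lit F N K k Ω U₀) = X + A' := by
      rw [conjJet_add, hX', hA']
    have hXAn : ‖X + A'‖ ≤ εC + aC := (norm_add_le _ _).trans (add_le_add hXn hn.le)
    have hCX := hCreal (X + A') hXA hXAn
    show ((JetSup.equiv _ _ (nabla115 ((F.P K).eta k) (unitsOfRecord F N U₀))).symm
        (star (JetSup.equiv _ _ (nabla115 ((F.P K).eta k) (unitsOfRecord F N U₀)) (mapT H 0 C 0 A' X))) : Space115Lit F N K k Ω U₀) = mapT H 0 C 0 A' X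
    rw [mapT_apply, map_zero, neg_zero, zero_add, zero_apply, zero_sub, conjJet_neg, hH, hCX]
  have hmem' : ((JetSup.equiv _ _ (nabla115 ((F.P K).eta k) (unitsOfRecord F N U₀))).symm
      (star (JetSup.equiv _ _ (nabla115 ((F.P K).eta k) (unitsOfRecord F N U₀)) (solA H 0 C 0 εC A'))) : Space115Lit F N K k Ω U₀) =
      solA H 0 C 0 εC A' := hmem
  rw [Emap, conjJet_neg, hmem']

/-- **`T47 A′ = A′ − HD(A′)` IS HERMITIAN** on the real slice (`‖A′‖ < a_C`). [cite: Balaban1985Variational, (47) p.285] -/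
theorem conjJet_T47_eq (RC : Regime H 0 C b 0 C₂ c₄ 0 aC εC)
    (hH : ∀ B : NegSize (F.L : ℝ) ((F.P K).eta k) levB 0 (Matrix (Fin N) (Fin N) ℂ),
      ((JetSup.equiv _ _ (nabla115 ((F.P K).eta k) (unitsOfRecord F N U₀))).symm
          (star (JetSup.equiv _ _ (nabla115 ((F.P K).eta k) (unitsOfRecord F N U₀)) (H B))) : Space115Lit F N K k Ω U₀) =
        H ((NegSup.equiv _ _).symm (star (NegSup.equiv _ _ B))))
    (hCreal : ∀ A : Space115Lit F N K k Ω U₀,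
      ((JetSup.equiv _ _ (nabla115 ((F.P K).eta k) (unitsOfRecord F N U₀))).symm
          (star (JetSup.equiv _ _ (nabla115 ((F.P K).eta k) (unitsOfRecord F N U₀)) A)) : Space115Lit F N K k Ω U₀) = A →
      ‖A‖ ≤ εC + aC → ((NegSup.equiv _ _).symm (star (NegSup.equiv _ _ (C A))) : NegSize (F.L : ℝ) ((F.P K).eta k) levB 0 (Matrix (Fin N) (Fin N) ℂ)) = C A)
    {A' : Space115Lit F N K k Ω U₀}
    (hA' : ((JetSup.equiv _ _ (nabla115 ((F.P K).eta k) (unitsOfRecord F N U₀))).symm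
      (star (JetSup.equiv _ _ (nabla115 ((F.P K).eta k) (unitsOfRecord F N U₀)) A')) : Space115Lit F N K k Ω U₀) = A') (hn : ‖A'‖ < aC) :
    ((JetSup.equiv _ _ (nabla115 ((F.P K).eta k) (unitsOfRecord F N U₀))).symm
        (star (JetSup.equiv _ _ (nabla115 ((F.P K).eta k) (unitsOfRecord F N U₀)) (T47 H C εC A'))) : Space115Lit F N K k Ω U₀) = T47 H C εC A' := by
  have hE := conjJet_Emap_eq F N K k Ω U₀ levB RC hH hCreal hA' hn
  rw [Emap_eq_sub, conjJet_sub, hA'] at hE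
  have h : ((JetSup.equiv _ _ (nabla115 ((F.P K).eta k) (unitsOfRecord F N U₀))).symm
      (star (JetSup.equiv _ _ (nabla115 ((F.P K).eta k) (unitsOfRecord F N U₀)) (T47 H C εC A'))) : Space115Lit F N K k Ω U₀) =
      A' - (A' - T47 H C εC A') := by rw [← hE, sub_sub_cancel]
  rw [h, sub_sub_cancel]

end Abstract

/-! ## §3  At def-Y's letters `H♭`, `C^{𝔰𝔩}` -/

section Record

variable [NeZero N] [Fact (0 < c0Rec F K k)] [Fact (∀ c, 0 < wBRec F K k c)] {a : ℝ}
  (hposb : ∀ x, x ≠ 0 → 0 < RCLike.re ⟪x, laplaceAOfRecord F N k U₀ (QOfRecord F N k U₀) (QflatOfRecord F N k) a x⟫_ℂ)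
  (hQ : Function.Surjective (QOfRecord F N k U₀)) {b C₂ c₄ aC εC : ℝ}

/-- `H♭` is real in the conjugation form (✓p821715). [cite: Balaban1985Variational, (45) p.285, (103) p.293] -/
theorem conjJet_H1OfRecordAtBgFlat (h : SmallBelow (avOfRecord F N K) k U₀) (B : NegSize (F.L : ℝ) ((F.P K).eta k) levB 0 (Matrix (Fin N) (Fin N) ℂ)) :
    ((JetSup.equiv _ _ (nabla115 ((F.P K).eta k) (unitsOfRecord F N U₀))).symm
        (star (JetSup.equiv _ _ (nabla115 ((F.P K).eta k) (unitsOfRecord F N U₀)) (H1OfRecordAtBgFlat F N K k Ω U₀ levB a hposb hQ B))) : Space115Lit F N K k Ω U₀) =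
      H1OfRecordAtBgFlat F N K k Ω U₀ levB a hposb hQ ((NegSup.equiv _ _).symm (star (NegSup.equiv _ _ B))) := by
  apply (JetSup.equiv _ _ (nabla115 ((F.P K).eta k) (unitsOfRecord F N U₀))).injective
  rw [Equiv.apply_symm_apply]
  funext bd
  rw [Pi.star_apply, equiv_H1OfRecordAtBgFlat_star F N k U₀ Ω levB h hposb hQ B bd]

variable (RC : Regime (H1OfRecordAtBgFlat F N K k Ω U₀ levB a hposb hQ) 0 (CslOfRecord F N K k Ω U₀ levB) b 0 C₂ c₄ 0 aC εC)
  (hCreal : ∀ A : Space115Lit F N K k Ω U₀,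
    ((JetSup.equiv _ _ (nabla115 ((F.P K).eta k) (unitsOfRecord F N U₀))).symm
        (star (JetSup.equiv _ _ (nabla115 ((F.P K).eta k) (unitsOfRecord F N U₀)) A)) : Space115Lit F N K k Ω U₀) = A →
    ‖A‖ ≤ εC + aC → ((NegSup.equiv _ _).symm (star (NegSup.equiv _ _ (CslOfRecord F N K k Ω U₀ levB A))) :
      NegSize (F.L : ℝ) ((F.P K).eta k) levB 0 (Matrix (Fin N) (Fin N) ℂ)) = CslOfRecord F N K k Ω U₀ levB A)

include RC hCreal in
/-- ★★ **AT def-Y's LETTERS: `HD(A′) = Emap H♭ C^{𝔰𝔩} ε_C A′` IS HERMITIAN for Hermitian `A′`, `‖A′‖ < a_C`** (guard; Sect. C regime and `hCreal` displayed).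
[cite: Balaban1985Variational, (45)–(50) p.285] -/
theorem conjJet_EmapOfRecord_eq (h : SmallBelow (avOfRecord F N K) k U₀) {A' : Space115Lit F N K k Ω U₀}
    (hA' : ((JetSup.equiv _ _ (nabla115 ((F.P K).eta k) (unitsOfRecord F N U₀))).symm
      (star (JetSup.equiv _ _ (nabla115 ((F.P K).eta k) (unitsOfRecord F N U₀)) A')) : Space115Lit F N K k Ω U₀) = A') (hn : ‖A'‖ < aC) :
    ((JetSup.equiv _ _ (nabla115 ((F.P K).eta k) (unitsOfRecord F N U₀))).symm
        (star (JetSup.equiv _ _ (nabla115 ((F.P K).eta k) (unitsOfRecord F N U₀))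
          (Emap (H1OfRecordAtBgFlat F N K k Ω U₀ levB a hposb hQ) (CslOfRecord F N K k Ω U₀ levB) εC A'))) : Space115Lit F N K k Ω U₀) =
      Emap (H1OfRecordAtBgFlat F N K k Ω U₀ levB a hposb hQ) (CslOfRecord F N K k Ω U₀ levB) εC A' :=
  conjJet_Emap_eq F N K k Ω U₀ levB RC (conjJet_H1OfRecordAtBgFlat F N K k Ω U₀ levB hposb hQ h) hCreal hA' hn

include RC hCreal in
/-- **`T47 A′` at def-Y's letters is Hermitian** on the real slice. [cite: Balaban1985Variational, (47) p.285] -/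
theorem conjJet_T47OfRecord_eq (h : SmallBelow (avOfRecord F N K) k U₀) {A' : Space115Lit F N K k Ω U₀}
    (hA' : ((JetSup.equiv _ _ (nabla115 ((F.P K).eta k) (unitsOfRecord F N U₀))).symm
      (star (JetSup.equiv _ _ (nabla115 ((F.P K).eta k) (unitsOfRecord F N U₀)) A')) : Space115Lit F N K k Ω U₀) = A') (hn : ‖A'‖ < aC) :
    ((JetSup.equiv _ _ (nabla115 ((F.P K).eta k) (unitsOfRecord F N U₀))).symm
        (star (JetSup.equiv _ _ (nabla115 ((F.P K).eta k) (unitsOfRecord F N U₀))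
          (T47 (H1OfRecordAtBgFlat F N K k Ω U₀ levB a hposb hQ) (CslOfRecord F N K k Ω U₀ levB) εC A'))) : Space115Lit F N K k Ω U₀) =
      T47 (H1OfRecordAtBgFlat F N K k Ω U₀ levB a hposb hQ) (CslOfRecord F N K k Ω U₀ levB) εC A' :=
  conjJet_T47_eq F N K k Ω U₀ levB RC (conjJet_H1OfRecordAtBgFlat F N K k Ω U₀ levB hposb hQ h) hCreal hA' hn

include RC hCreal in
/-- ★★ **`HD₃(A′) = HD(A′) − H♭C⁽²⁾(A′)` IS HERMITIAN** on the real slice (✓p821931 `quadPart_CslOfRecord_conj` for the second-order part).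
[cite: Balaban1985Variational, (78) p.290, (56) p.286] -/
theorem conjJet_E3OfRecord_eq (h : SmallBelow (avOfRecord F N K) k U₀) {A' : Space115Lit F N K k Ω U₀}
    (hA' : ((JetSup.equiv _ _ (nabla115 ((F.P K).eta k) (unitsOfRecord F N U₀))).symm
      (star (JetSup.equiv _ _ (nabla115 ((F.P K).eta k) (unitsOfRecord F N U₀)) A')) : Space115Lit F N K k Ω U₀) = A') (hn : ‖A'‖ < aC) :
    ((JetSup.equiv _ _ (nabla115 ((F.P K).eta k) (unitsOfRecord F N U₀))).symm
        (star (JetSup.equiv _ _ (nabla115 ((F.P K).eta k) (unitsOfRecord F N U₀))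
          (E3 (H1OfRecordAtBgFlat F N K k Ω U₀ levB a hposb hQ) (CslOfRecord F N K k Ω U₀ levB) εC A'))) : Space115Lit F N K k Ω U₀) =
      E3 (H1OfRecordAtBgFlat F N K k Ω U₀ levB a hposb hQ) (CslOfRecord F N K k Ω U₀ levB) εC A' := by
  have hq := quadPart_CslOfRecord_conj F N K k Ω U₀ levB h A'
  rw [hA'] at hq
  rw [E3, conjJet_sub, conjJet_EmapOfRecord_eq F N K k Ω U₀ levB hposb hQ RC hCreal h hA' hn, conjJet_H1OfRecordAtBgFlat F N K k Ω U₀ levB hposb hQ h, ← hq]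

include RC hCreal in
set_option maxHeartbeats 800000 in
/-- ★★ **THE DERIVATIVE `D(HD)(A′)` MAPS HERMITIAN DIRECTIONS TO HERMITIAN JETS** at a Hermitian `A′` with `‖A′‖ < a_C` (the real curve `t ↦ HD(A′ + tY)` is Hermitian-valued near
`0` by §3, `HD` is analytic on the `a_C`-ball by lit ✓`analyticOnNhd_Emap` under `Prop4Hyp`, and ✓`fixed_of_hasDerivAt`). [cite: Balaban1985Variational, (85)–(89) p.291] -/
theorem conjJet_fderiv_EmapOfRecord_eq (h : SmallBelow (avOfRecord F N K) k U₀) (hP : Prop4Hyp (CslOfRecord F N K k Ω U₀ levB) C₂ c₄)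
    {A' Y : Space115Lit F N K k Ω U₀}
    (hA' : ((JetSup.equiv _ _ (nabla115 ((F.P K).eta k) (unitsOfRecord F N U₀))).symm
      (star (JetSup.equiv _ _ (nabla115 ((F.P K).eta k) (unitsOfRecord F N U₀)) A')) : Space115Lit F N K k Ω U₀) = A') (hn : ‖A'‖ < aC)
    (hY : ((JetSup.equiv _ _ (nabla115 ((F.P K).eta k) (unitsOfRecord F N U₀))).symm
      (star (JetSup.equiv _ _ (nabla115 ((F.P K).eta k) (unitsOfRecord F N U₀)) Y)) : Space115Lit F N K k Ω U₀) = Y) :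
    ((JetSup.equiv _ _ (nabla115 ((F.P K).eta k) (unitsOfRecord F N U₀))).symm
        (star (JetSup.equiv _ _ (nabla115 ((F.P K).eta k) (unitsOfRecord F N U₀))
          (fderiv ℂ (Emap (H1OfRecordAtBgFlat F N K k Ω U₀ levB a hposb hQ) (CslOfRecord F N K k Ω U₀ levB) εC) A' Y))) : Space115Lit F N K k Ω U₀) =
      fderiv ℂ (Emap (H1OfRecordAtBgFlat F N K k Ω U₀ levB a hposb hQ) (CslOfRecord F N K k Ω U₀ levB) εC) A' Y := by
  set f := Emap (H1OfRecordAtBgFlat F N K k Ω U₀ levB a hposb hQ) (CslOfRecord F N K k Ω U₀ levB) εC with hf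
  have hτc := continuous_conjJet F N K k Ω U₀
  have hτlin : ∀ (r : ℝ) (u v : Space115Lit F N K k Ω U₀),
      ((JetSup.equiv _ _ (nabla115 ((F.P K).eta k) (unitsOfRecord F N U₀))).symm
          (star (JetSup.equiv _ _ (nabla115 ((F.P K).eta k) (unitsOfRecord F N U₀)) (r • (u - v)))) : Space115Lit F N K k Ω U₀) =
        r • (((JetSup.equiv _ _ (nabla115 ((F.P K).eta k) (unitsOfRecord F N U₀))).symm
            (star (JetSup.equiv _ _ (nabla115 ((F.P K).eta k) (unitsOfRecord F N U₀)) u)) : Space115Lit F N K k Ω U₀) -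
          (JetSup.equiv _ _ (nabla115 ((F.P K).eta k) (unitsOfRecord F N U₀))).symm
            (star (JetSup.equiv _ _ (nabla115 ((F.P K).eta k) (unitsOfRecord F N U₀)) v))) := fun r u v => by
    rw [← Complex.coe_smul, ← Complex.coe_smul, conjJet_smul, Complex.conj_ofReal, conjJet_sub]
  -- differentiability of `HD` at `A′`
  have hA'mem : A' ∈ ball (0 : Space115Lit F N K k Ω U₀) aC := by rwa [mem_ball, dist_zero_right]
  have hd : HasFDerivAt f (fderiv ℂ f A') A' := ((analyticOnNhd_Emap RC hP) A' hA'mem).differentiableAt.hasFDerivAt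
  -- the real curve `t ↦ HD(A′ + tY)` and its derivative at `0`
  have hcurve : HasDerivAt (fun t : ℝ => f (A' + ((t : ℂ)) • Y)) (fderiv ℂ f A' Y) 0 := by
    have hγ : HasDerivAt (fun t : ℝ => A' + ((t : ℂ)) • Y) Y 0 := (hasDerivAt_realLine F N K k Ω U₀ Y 0).const_add A'
    have hd0 : HasFDerivAt f (fderiv ℂ f A') (A' + (((0 : ℝ) : ℂ)) • Y) := by rwa [Complex.ofReal_zero, zero_smul, add_zero]
    have hc := (hd0.restrictScalars ℝ).comp_hasDerivAt (0 : ℝ) hγ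
    simpa only [Function.comp_def, ContinuousLinearMap.coe_restrictScalars'] using hc
  -- the curve is Hermitian-valued near `0`
  have hball : ∀ᶠ t : ℝ in 𝓝 0, ‖A' + ((t : ℂ)) • Y‖ < aC := by
    have hc : Continuous fun t : ℝ => ‖A' + ((t : ℂ)) • Y‖ := (continuous_const.add (Complex.continuous_ofReal.smul continuous_const)).norm
    have h0 : ‖A' + (((0 : ℝ) : ℂ)) • Y‖ < aC := by rwa [Complex.ofReal_zero, zero_smul, add_zero]
    exact hc.continuousAt.eventually (Iio_mem_nhds h0)
  have hreal : ∀ᶠ t : ℝ in 𝓝 0, ((JetSup.equiv _ _ (nabla115 ((F.P K).eta k) (unitsOfRecord F N U₀))).symm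
      (star (JetSup.equiv _ _ (nabla115 ((F.P K).eta k) (unitsOfRecord F N U₀)) (f (A' + ((t : ℂ)) • Y)))) : Space115Lit F N K k Ω U₀) =
      f (A' + ((t : ℂ)) • Y) := by
    filter_upwards [hball] with t ht
    have hAt : ((JetSup.equiv _ _ (nabla115 ((F.P K).eta k) (unitsOfRecord F N U₀))).symm
        (star (JetSup.equiv _ _ (nabla115 ((F.P K).eta k) (unitsOfRecord F N U₀)) (A' + ((t : ℂ)) • Y))) : Space115Lit F N K k Ω U₀) =
        A' + ((t : ℂ)) • Y := by
      rw [conjJet_add, conjJet_smul, Complex.conj_ofReal, hA', hY]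
    exact conjJet_EmapOfRecord_eq F N K k Ω U₀ levB hposb hQ RC hCreal h hAt ht
  exact fixed_of_hasDerivAt hτc hτlin hreal hcurve

end Record

end Summit.QuantumFields.YangMills.Theorems.N07EmapOfRecordRealSlice

end
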